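import Summits.Ventures.QEC.Thresholds.PlanarPhenomenologicalDepolarizing
import Summits.Ventures.QEC.Thresholds.PlanarSurfaceCodeMWPMThresholds
import HarnessLib

/-!
# The PLANAR surface codes under PHENOMENOLOGICAL DEPOLARIZING noise, space-time BOUNDARY-MWPM on both records:
# `p ≤ .0151`, `q_X, q_Z ≤ .0101` ⇒ `P_fail → 0` — UNCONDITIONAL, kernel

Venture QEC, `Summits/Ventures/QEC/Thresholds/` (LADDER-QEC rung Q5 «toric/surface + MWPM»; qec-type-09 gen 5, item 09.PHDEPOL; companion of
`PlanarPhenomenologicalDepolarizing.lean`). qec-type-09 gen 4's `MatchingDecodersBoundary.lean` / `PlanarCodeMatching.lean` prove that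
space-time matching decoders with a virtual BOUNDARY vertex (`boundaryDecoder`, any graphlike presentation `ι` of `planarHX` /
`planarHZ`, any link metric on the space-time checks, `isMinWeight_boundaryDecoder_st`) are minimum-weight space-time decoders of the
planar code's two records. Feeding them to `planar_depolPhenom_belowThreshold_of_rate` / `_0151_0101` (three-rate law, sector-wise
decoding):

| theorem | statement |
|---|---|
| `planar_depolPhenom_mwpm_belowThreshold_of_rate` | boundary-MWPM on both records, `2p/3, q_X, q_Z ≤ ρ ≤ 1/2`, `100ρ(1-ρ) < 1` ⇒ `P_fail → 0` |
| `planar_depolPhenom_mwpm_belowThreshold_0151_0101` | decimals **`p ≤ .0151`, `q_X, q_Z ≤ .0101`** |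

UNCONDITIONAL, tier CERTIFIED (kernel), axioms standard, 0 named facts; certified LOWER bound on the region for the boundary-MWPM decoder
class (correlation-blind); constants are the cluster-expansion ones. Theorem-only file.

## References

* [DennisEtAl2002] E. Dennis, A. Kitaev, A. Landahl, J. Preskill, J. Math. Phys. 43 (2002) 4452, §4.4 p. 18 and §5.1 p. 19 (matching,
  also with boundaries).
* [DumerKovalevPryadko2015] I. Dumer, A. A. Kovalev, L. P. Pryadko, PRL 115 (2015) 050502, Thm 3 with p. 5, eq. (succesful-decoding-depolarizing).
* [KorteVygen2002] B. Korte, J. Vygen, *Combinatorial Optimization* (2002), §12.2 Thm 12.9.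
* [AliferisGottesmanPreskill2006] P. Aliferis, D. Gottesman, J. Preskill, arXiv:quant-ph/0504218, §8.2 (chunk p0026 L11: depolarizing).
-/

noncomputable section

namespace Summit.Ventures.QEC.Thresholds

open Filter Topology Finset Matrix
open Literature.InformationTheory.QuantumCodes

/-- **Planar surface codes, three-rate phenomenological depolarizing noise, boundary-MWPM on both records**: for every poly-bounded
schedule, all graphlike presentations `ιZ` of `planarHX` and `ιX` of `planarHZ` (virtual boundary vertex), all link metrics and all
matching decoders `DZ'`, `DX'`, and all rates with `2p/3, q_X, q_Z ≤ ρ ≤ 1/2`, `100ρ(1-ρ) < 1`: the failure probability of sector-wise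
decoding by `boundaryDecoder (DZ' k)`, `boundaryDecoder (DX' k)` tends to `0`. UNCONDITIONAL, kernel.
[cite: DennisEtAl2002, §5.1 p. 19] [cite: DumerKovalevPryadko2015, Thm 3 with p. 5 and eq. (succesful-decoding-depolarizing)] -/
theorem planar_depolPhenom_mwpm_belowThreshold_of_rate (T : ℕ → ℕ) (hT : ToricCode.IsPolyBounded T)
    {ιZ : ∀ k, PlanarQubit k → Sym2 (Option (PlanarCheck k))} (hιZ : ∀ k, IsGraphlikeVia (planarHX k) (ιZ k))
    {ιX : ∀ k, PlanarQubit k → Sym2 (Option (PlanarZCheck k))} (hιX : ∀ k, IsGraphlikeVia (planarHZ k) (ιX k))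
    (mZ : ∀ k, EdgeMetric (stEndsOf (ιZ k) (T k))) (mX : ∀ k, EdgeMetric (stEndsOf (ιX k) (T k)))
    {DZ' : ∀ k, Decoder (Option (PlanarCheck k × Fin (T k + 1)) → ZMod 2)
      (HistoryLoc (PlanarQubit k) (PlanarCheck k) (T k) → ZMod 2)}
    {DX' : ∀ k, Decoder (Option (PlanarZCheck k × Fin (T k + 1)) → ZMod 2)
      (HistoryLoc (PlanarQubit k) (PlanarZCheck k) (T k) → ZMod 2)}
    (hDZ : ∀ k, IsMatchingDecoder (mZ k) (DZ' k)) (hDX : ∀ k, IsMatchingDecoder (mX k) (DX' k))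
    {p qX qZ ρ : ℝ} (hp0 : 0 ≤ p) (hpρ : 2 * p / 3 ≤ ρ) (hqX0 : 0 ≤ qX) (hqXρ : qX ≤ ρ) (hqZ0 : 0 ≤ qZ)
    (hqZρ : qZ ≤ ρ) (hρ : ρ ≤ 1 / 2) (h100 : 100 * (ρ * (1 - ρ)) < 1) :
    Tendsto (fun k => (PlanarCode.code k).depolPhenomFailureProb (T k) (boundaryDecoder (DZ' k))
      (boundaryDecoder (DX' k)) p qX qZ) atTop (𝓝 0) :=
  planar_depolPhenom_belowThreshold_of_rate T hT (fun k => boundaryDecoder (DZ' k)) (fun k => boundaryDecoder (DX' k))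
    (fun k => isMinWeight_boundaryDecoder_st (hιZ k) (T k) (hDZ k))
    (fun k => isMinWeight_boundaryDecoder_st (hιX k) (T k) (hDX k)) hp0 hpρ hqX0 hqXρ hqZ0 hqZρ hρ h100

/-- **Decimal form: `p ≤ .0151`, `q_X, q_Z ≤ .0101` ⇒ `P_fail → 0`** for boundary-MWPM decoding of both records of the planar surface
codes under phenomenological depolarizing noise — UNCONDITIONAL, kernel. [cite: DennisEtAl2002, §5.1 p. 19] [cite: DumerKovalevPryadko2015, Thm 3 with p. 5] -/
theorem planar_depolPhenom_mwpm_belowThreshold_0151_0101 (T : ℕ → ℕ) (hT : ToricCode.IsPolyBounded T)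
    {ιZ : ∀ k, PlanarQubit k → Sym2 (Option (PlanarCheck k))} (hιZ : ∀ k, IsGraphlikeVia (planarHX k) (ιZ k))
    {ιX : ∀ k, PlanarQubit k → Sym2 (Option (PlanarZCheck k))} (hιX : ∀ k, IsGraphlikeVia (planarHZ k) (ιX k))
    (mZ : ∀ k, EdgeMetric (stEndsOf (ιZ k) (T k))) (mX : ∀ k, EdgeMetric (stEndsOf (ιX k) (T k)))
    {DZ' : ∀ k, Decoder (Option (PlanarCheck k × Fin (T k + 1)) → ZMod 2)
      (HistoryLoc (PlanarQubit k) (PlanarCheck k) (T k) → ZMod 2)}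
    {DX' : ∀ k, Decoder (Option (PlanarZCheck k × Fin (T k + 1)) → ZMod 2)
      (HistoryLoc (PlanarQubit k) (PlanarZCheck k) (T k) → ZMod 2)}
    (hDZ : ∀ k, IsMatchingDecoder (mZ k) (DZ' k)) (hDX : ∀ k, IsMatchingDecoder (mX k) (DX' k))
    {p qX qZ : ℝ} (hp0 : 0 ≤ p) (hp : p ≤ 0.0151) (hqX0 : 0 ≤ qX) (hqX : qX ≤ 0.0101) (hqZ0 : 0 ≤ qZ)
    (hqZ : qZ ≤ 0.0101) :
    Tendsto (fun k => (PlanarCode.code k).depolPhenomFailureProb (T k) (boundaryDecoder (DZ' k))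
      (boundaryDecoder (DX' k)) p qX qZ) atTop (𝓝 0) :=
  planar_depolPhenom_mwpm_belowThreshold_of_rate T hT hιZ hιX mZ mX hDZ hDX (ρ := 0.0101) hp0 (by linarith) hqX0 hqX hqZ0
    hqZ (by norm_num) (by norm_num)

end Summit.Ventures.QEC.Thresholds

end
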